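import Summits.CriticalPhenomena.PercolationContinuityZ3.Theorems.PercNearOneGluingNoHeavyPcintNawRandMemSym
import Summits.CriticalPhenomena.PercolationContinuityZ3.Theorems.PercNearOneGluingNoHeavyPcintWinKernelRange
import HarnessLib

/-!
# PCINT lane, reduced-state B2r certificates: the computable (kernel) layer — geometry, step, counts, symmetries

Cell `prim-pcint` (PAPER-2 track (iii)), seat `prim-pcint-1` (gen 5); support file (`--supports stmt-CriticalPhenomena-4575`).
Does NOT build on p205010.  Kernel-evaluable mirrors (`decide +kernel`, natural-number and integer-list arithmetic only) of the
objects of `…PcintNawRandMem`: states as lists of (site as an integer list of length `d`, age) (`NawK.KState`, denotation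
`NawK.toM`), the NAW step `NawK.nstepK`, the gap count `NawK.ngapK`, the corner flag `NawK.ncornerK`, lattice symmetries as
tables `NawK.actK`/`NawK.spermKL`, and set comparison `NawK.seteqK`; with the SOUNDNESS bridges `NawK.nstep_toM`
(`nstep τ (toM L) a = (nstepK τ d L a).map toM`), `NawK.ngapK_le_ngap`, `NawK.ncorner_of_ncornerK`, `NawK.toM_actK`,
`NawK.toM_eq_of_seteqK`.  Built on the integer-list geometry `WinK.toL/addL/adjL/toSite` of `…PcintWinKernel` (prim-pcint-2).
The table format, the row check and the final assembly are in `…PcintNawRandMemKernelCert`.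
-/

namespace Summit.CriticalPhenomena.PercolationContinuityZ3.Theorems.Pcint

open Finset Literature.Probability.Percolation Literature.Probability.LatticeModels

/-! ## Kernel layer: computable reduced-state B2r certificates (`NawK`) -/

namespace NawK

open WinK (toSite toL addL adjL toSite_addL toSite_toL adj_iff_adjL toSite_inj length_toL length_addL)

variable {d : ℕ}

/-! ### Integer-list geometry -/

/-- Componentwise negation. [folklore] -/
def negL (x : List ℤ) : List ℤ := x.map fun z => -z

/-- Componentwise difference. [folklore] -/
def subL (x y : List ℤ) : List ℤ := List.zipWith (· - ·) x y

/-- `ℓ¹` norm of an integer list. [folklore] -/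
def l1L (x : List ℤ) : ℕ := (x.map Int.natAbs).sum

/-- Negation preserves length. [folklore] -/
@[simp] theorem length_negL (x : List ℤ) : (negL x).length = x.length := by simp [negL]

/-- Length of a difference. [folklore] -/
theorem length_subL {x y : List ℤ} (hx : x.length = d) (hy : y.length = d) : (subL x y).length = d := by
  simp [subL, hx, hy]

/-- `getD` inside the list is `getElem`. [folklore] -/
private theorem getD_eq_getElem'' {l : List ℤ} {i : ℕ} (h : i < l.length) : l.getD i 0 = l[i] := by
  rw [List.getD_eq_getElem?_getD, List.getElem?_eq_getElem h, Option.getD_some]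

/-- `toSite` commutes with negation (length `d`). [folklore] -/
theorem toSite_negL {x : List ℤ} (hx : x.length = d) : (toSite (negL x) : Site d) = -toSite x := by
  funext i
  have h1 : (i : ℕ) < (negL x).length := by rw [length_negL, hx]; exact i.isLt
  have h2 : (i : ℕ) < x.length := by rw [hx]; exact i.isLt
  simp only [toSite, Pi.neg_apply]
  rw [getD_eq_getElem'' h1, getD_eq_getElem'' h2]
  simp [negL]

/-- `toSite` commutes with subtraction (length `d`). [folklore] -/
theorem toSite_subL {x y : List ℤ} (hx : x.length = d) (hy : y.length = d) :
    (toSite (subL x y) : Site d) = toSite x - toSite y := by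
  funext i
  have h1 : (i : ℕ) < (subL x y).length := by rw [length_subL hx hy]; exact i.isLt
  have h2 : (i : ℕ) < x.length := by rw [hx]; exact i.isLt
  have h3 : (i : ℕ) < y.length := by rw [hy]; exact i.isLt
  simp only [toSite, Pi.sub_apply]
  rw [getD_eq_getElem'' h1, getD_eq_getElem'' h2, getD_eq_getElem'' h3]
  simp [subL, List.getElem_zipWith]

/-- The list `ℓ¹` norm is the `ℓ¹` norm (length `d`). [folklore] -/
theorem l1_toSite {x : List ℤ} (hx : x.length = d) : l1 (toSite x : Site d) = l1L x := by
  unfold l1 l1L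
  subst hx
  rw [← List.sum_ofFn (f := fun i : Fin x.length => (toSite x i : ℤ).natAbs)]
  congr 1
  apply List.ext_getElem (by simp)
  intro i h1 h2
  simp only [List.getElem_ofFn, List.getElem_map, toSite]
  rw [getD_eq_getElem'' (by simpa using h2)]

/-! ### States, letters, the automaton -/

/-- Kernel states: lists of (site as integer list, age). [folklore] -/
abbrev KState : Type := List (List ℤ × ℕ)

/-- The dangerous-set state denoted by a kernel state. [folklore] -/
def toM (L : KState) : MState d := (L.map fun q => ((toSite q.1 : Site d), q.2)).toFinset

/-- Membership in the denoted state. [folklore] -/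
theorem mem_toM {L : KState} {q : Site d × ℕ} : q ∈ (toM L : MState d) ↔ ∃ x ∈ L, ((toSite x.1 : Site d), x.2) = q := by
  simp [toM]

/-- Well-formedness: every site list has length `d`. [folklore] -/
def WF (d : ℕ) (L : KState) : Bool := L.all fun q => q.1.length == d

/-- In a well-formed state every site list has length `d`. [folklore] -/
theorem length_of_WF {L : KState} (h : WF d L = true) {x : List ℤ × ℕ} (hx : x ∈ L) : x.1.length = d := by
  rw [WF, List.all_eq_true] at h
  simpa using h x hx

/-- The `2d` letters, listed. [folklore] -/
def letters (d : ℕ) : List (Fin d × Bool) := (List.finRange d).flatMap fun i => [(i, true), (i, false)]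

/-- Every letter is listed. [folklore] -/
theorem mem_letters (a : Fin d × Bool) : a ∈ letters d := by
  rcases a with ⟨i, b⟩
  simp only [letters, List.mem_flatMap, List.mem_finRange, true_and, List.mem_cons, Prod.mk.injEq]
  exact ⟨i, by cases b <;> simp⟩

/-- The letter list has no duplicates. [folklore] -/
theorem nodup_letters : (letters d).Nodup := by
  unfold letters
  refine List.nodup_flatMap.2 ⟨fun i _ => by simp, ?_⟩
  refine (List.nodup_finRange d).pairwise_of_forall_ne fun i _ j _ hij => ?_
  simp [List.disjoint_left, hij]

/-- Kernel NAW step (mirror of `nstep`/`mstep`). [folklore] -/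
def nstepK (τ d : ℕ) (L : KState) (a : Fin d × Bool) : Option KState :=
  if L.any (fun q => decide (q.1 = toL d a) || adjL d q.1 (toL d a)) then none
  else some ((negL (toL d a), 1) :: L.filterMap fun q =>
    if q.2 + 1 ≤ τ - 1 ∧ l1L (subL q.1 (toL d a)) ≤ τ - (q.2 + 1) then some (subL q.1 (toL d a), q.2 + 1) else none)

/-- Kernel detected gap count (mirror of `ngap`). [folklore] -/
def ngapK (d : ℕ) (L : KState) (a : Fin d × Bool) : ℕ :=
  ((letters d).filter fun b => L.any fun q => decide (2 ≤ q.2) && adjL d q.1 (addL (toL d a) (toL d b))).length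

/-- Kernel claimed corner (mirror of `ncorner`). [folklore] -/
def ncornerK (d : ℕ) (L : KState) (a : Fin d × Bool) : Bool :=
  L.any fun q₁ => (q₁.2 == 1) && (q₁.1.getD a.1.1 0 == 0) &&
    L.all fun q => !decide (2 ≤ q.2) || !adjL d q.1 (addL q₁.1 (toL d a))

/-! ### Symmetries as tables -/

/-- Apply a signed coordinate permutation, given as a list of (source coordinate, keep-sign) pairs. [folklore] -/
def actSite (gl : List (ℕ × Bool)) (x : List ℤ) : List ℤ :=
  gl.map fun ks => if ks.2 then x.getD ks.1 0 else -x.getD ks.1 0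

/-- Apply a symmetry table to a kernel state. [folklore] -/
def actK (gl : List (ℕ × Bool)) (L : KState) : KState := L.map fun q => (actSite gl q.1, q.2)

/-- The table of a signed permutation. [folklore] -/
def spermKL (g : SPerm d) : List (ℕ × Bool) := List.ofFn fun i : Fin d => ((g.1 i : ℕ), g.2 i)

/-- **The table action is the lattice action.** [folklore] -/
theorem toSite_actSite (g : SPerm d) (x : List ℤ) : (toSite (actSite (spermKL g) x) : Site d) = smulSite g (toSite x) := by
  funext i
  have hlen : (actSite (spermKL g) x).length = d := by simp [actSite, spermKL]
  have h1 : (i : ℕ) < (actSite (spermKL g) x).length := by rw [hlen]; exact i.isLt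
  simp only [toSite]
  rw [getD_eq_getElem'' h1]
  simp only [actSite, spermKL, List.getElem_map, List.getElem_ofFn, Fin.eta, smulSite, toSite]

/-- **The table action on kernel states denotes the lattice action on states.** [folklore] -/
theorem toM_actK (g : SPerm d) (L : KState) : (toM (actK (spermKL g) L) : MState d) = smulState g (toM L) := by
  ext q
  rw [mem_toM, mem_smulState]
  simp only [actK, List.mem_map]
  constructor
  · rintro ⟨x, ⟨y, hy, rfl⟩, rfl⟩
    exact ⟨toSite y.1, mem_toM.2 ⟨y, hy, rfl⟩, toSite_actSite g y.1⟩
  · rintro ⟨r, hr, hq⟩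
    obtain ⟨y, hy, hyq⟩ := mem_toM.1 hr
    simp only [Prod.mk.injEq] at hyq
    refine ⟨(actSite (spermKL g) y.1, y.2), ⟨y, hy, rfl⟩, ?_⟩
    rcases q with ⟨q1, q2⟩
    simp only [Prod.mk.injEq] at hq ⊢
    exact ⟨by rw [toSite_actSite, hyq.1, hq], hyq.2⟩

/-- Set inclusion and equality of kernel states (syntactic on elements). [folklore] -/
def subsetK (L L' : KState) : Bool := L.all fun q => L'.any fun q' => decide (q' = q)
/-- Set equality of kernel states. [folklore] -/
def seteqK (L L' : KState) : Bool := subsetK L L' && subsetK L' L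

/-- A passed inclusion test gives inclusion of the denoted states. [folklore] -/
theorem toM_subset_of_subsetK {L L' : KState} (h : subsetK L L' = true) : (toM L : MState d) ⊆ toM L' := by
  intro q hq
  obtain ⟨x, hx, rfl⟩ := mem_toM.1 hq
  rw [subsetK, List.all_eq_true] at h
  have := h x hx
  rw [List.any_eq_true] at this
  obtain ⟨x', hx', hxx⟩ := this
  rw [decide_eq_true_eq] at hxx
  exact mem_toM.2 ⟨x', hx', by rw [hxx]⟩

/-- A passed set-equality test gives equality of the denoted states. [folklore] -/
theorem toM_eq_of_seteqK {L L' : KState} (h : seteqK L L' = true) : (toM L : MState d) = toM L' := by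
  rw [seteqK, Bool.and_eq_true] at h
  exact Finset.Subset.antisymm (toM_subset_of_subsetK h.1) (toM_subset_of_subsetK h.2)

/-! ### Soundness of the kernel step, gap count and corner flag -/

/-- The kernel rejection test fires iff a remembered site equals or is adjacent to the new vertex. [folklore] -/
theorem any_reject_iff {L : KState} (hL : WF d L = true) (a : Fin d × Bool) :
    (L.any fun q => decide (q.1 = toL d a) || adjL d q.1 (toL d a)) = true ↔
      (∃ q ∈ (toM L : MState d), (zdGraph d).Adj q.1 (stepVec a)) ∨ ∃ q ∈ (toM L : MState d), q.1 = stepVec a := by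
  rw [List.any_eq_true]
  constructor
  · rintro ⟨x, hx, h⟩
    rw [Bool.or_eq_true, decide_eq_true_eq] at h
    rcases h with h | h
    · exact Or.inr ⟨_, mem_toM.2 ⟨x, hx, rfl⟩, by rw [h, toSite_toL]⟩
    · exact Or.inl ⟨_, mem_toM.2 ⟨x, hx, rfl⟩, by
        rw [← toSite_toL]; exact (adj_iff_adjL (length_of_WF hL hx) (length_toL a)).2 h⟩
  · rintro (⟨q, hq, h⟩ | ⟨q, hq, h⟩)
    · obtain ⟨x, hx, rfl⟩ := mem_toM.1 hq
      refine ⟨x, hx, ?_⟩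
      rw [Bool.or_eq_true]; right
      rw [← toSite_toL] at h
      exact (adj_iff_adjL (length_of_WF hL hx) (length_toL a)).1 h
    · obtain ⟨x, hx, rfl⟩ := mem_toM.1 hq
      refine ⟨x, hx, ?_⟩
      rw [Bool.or_eq_true, decide_eq_true_eq]; left
      exact toSite_inj (length_of_WF hL hx) (length_toL a) (by rw [toSite_toL]; exact h)

/-- **The kernel step is the dangerous-set step.** [folklore] -/
theorem nstep_toM {τ : ℕ} {L : KState} (hL : WF d L = true) (a : Fin d × Bool) :
    nstep τ (toM L : MState d) a = (nstepK τ d L a).map toM := by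
  unfold nstep nstepK mstep
  by_cases hrej : (L.any fun q => decide (q.1 = toL d a) || adjL d q.1 (toL d a)) = true
  · rw [if_pos hrej, Option.map_none]
    rcases (any_reject_iff hL a).1 hrej with h | h
    · rw [if_pos h]
    · by_cases h' : ∃ q ∈ (toM L : MState d), (zdGraph d).Adj q.1 (stepVec a)
      · rw [if_pos h']
      · rw [if_neg h', if_pos h]
  · have hno := fun h => hrej ((any_reject_iff hL a).2 h)
    rw [if_neg hrej, if_neg (fun h => hno (Or.inl h)), if_neg (fun h => hno (Or.inr h)), Option.map_some]
    congr 1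
    ext q
    rw [Finset.mem_insert, Finset.mem_filter, Finset.mem_image, mem_toM]
    constructor
    · rintro (rfl | ⟨⟨q', hq', rfl⟩, hjτ, hl⟩)
      · exact ⟨(negL (toL d a), 1), List.mem_cons.2 (Or.inl rfl), by rw [toSite_negL (length_toL a), toSite_toL]⟩
      · obtain ⟨x, hx, rfl⟩ := mem_toM.1 hq'
        have hxl := length_of_WF hL hx
        simp only at hjτ hl
        refine ⟨(subL x.1 (toL d a), x.2 + 1), List.mem_cons.2 (Or.inr (List.mem_filterMap.2 ⟨x, hx, ?_⟩)), ?_⟩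
        · rw [if_pos]
          refine ⟨hjτ, ?_⟩
          rw [← l1_toSite (length_subL hxl (length_toL a)), toSite_subL hxl (length_toL a), toSite_toL]
          exact hl
        · simp only
          rw [toSite_subL hxl (length_toL a), toSite_toL]
    · rintro ⟨x, hx, rfl⟩
      rcases List.mem_cons.1 hx with rfl | hx
      · left; simp only; rw [toSite_negL (length_toL a), toSite_toL]
      · right
        obtain ⟨y, hy, hyx⟩ := List.mem_filterMap.1 hx
        have hyl := length_of_WF hL hy
        split_ifs at hyx with hcond
        cases hyx
        refine ⟨⟨(toSite y.1, y.2), mem_toM.2 ⟨y, hy, rfl⟩, ?_⟩, hcond.1, ?_⟩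
        · simp only
          rw [toSite_subL hyl (length_toL a), toSite_toL]
        · have := hcond.2
          show l1 (toSite (subL y.1 (toL d a)) : Site d) ≤ τ - (y.2 + 1)
          rwa [l1_toSite (length_subL hyl (length_toL a))]

/-- **The kernel gap count does not exceed the detected gap count.** [folklore] -/
theorem ngapK_le_ngap {L : KState} (hL : WF d L = true) (a : Fin d × Bool) : ngapK d L a ≤ ngap (toM L : MState d) a := by
  classical
  unfold ngapK ngap
  set P : Fin d × Bool → Bool := fun b => L.any fun q => decide (2 ≤ q.2) && adjL d q.1 (addL (toL d a) (toL d b))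
    with hP
  have hnd : ((letters d).filter fun b => P b).Nodup := nodup_letters.filter _
  rw [← List.toFinset_card_of_nodup hnd]
  refine Finset.card_le_card_of_injOn (fun b => stepVec a + stepVec b) (fun b hb => ?_) ?_
  · rw [Finset.mem_coe, List.mem_toFinset, List.mem_filter] at hb
    obtain ⟨-, hb⟩ := hb
    rw [hP] at hb
    simp only [List.any_eq_true, Bool.and_eq_true, decide_eq_true_eq] at hb
    obtain ⟨x, hx, hx2, hadj⟩ := hb
    rw [Finset.mem_coe, ngapSet, Finset.mem_filter, mem_nbrSites]
    refine ⟨(zdGraph_adj_iff_stepVec _ _).2 ⟨b, rfl⟩, (toSite x.1, x.2), mem_toM.2 ⟨x, hx, rfl⟩, hx2, ?_⟩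
    have := (adj_iff_adjL (length_of_WF hL hx) (length_addL (length_toL a) (length_toL b))).2 hadj
    rwa [toSite_addL (length_toL a) (length_toL b), toSite_toL, toSite_toL] at this
  · intro b _ b' _ h
    have h' : stepVec b = stepVec b' := add_left_cancel h
    rcases b with ⟨i, s⟩; rcases b' with ⟨i', s'⟩
    have hi : i = i' := fst_eq_of_stepVec_eq h'
    subst hi
    have := congrFun h' i
    cases s <;> cases s' <;> simp [stepVec] at this ⊢

/-- **A kernel corner claim is a corner claim.** [folklore] -/
theorem ncorner_of_ncornerK {L : KState} (hL : WF d L = true) (a : Fin d × Bool) (h : ncornerK d L a = true) :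
    ncorner (toM L : MState d) a = true := by
  unfold ncornerK at h
  unfold ncorner
  rw [decide_eq_true_iff]
  rw [List.any_eq_true] at h
  obtain ⟨x, hx, h⟩ := h
  simp only [Bool.and_eq_true, beq_iff_eq, List.all_eq_true, Bool.or_eq_true, Bool.not_eq_true',
    decide_eq_false_iff_not, not_le] at h
  obtain ⟨⟨h1, h0⟩, hall⟩ := h
  have hxl := length_of_WF hL hx
  refine ⟨(toSite x.1, x.2), mem_toM.2 ⟨x, hx, rfl⟩, h1, h0, fun q hq hq2 hadj => ?_⟩
  obtain ⟨y, hy, rfl⟩ := mem_toM.1 hq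
  have := hall y hy
  rcases this with hlt | hna
  · exact absurd hq2 (by simpa using hlt)
  · have hyl := length_of_WF hL hy
    have h' : adjL d y.1 (addL x.1 (toL d a)) = true :=
      (adj_iff_adjL hyl (length_addL hxl (length_toL a))).1 (by rw [toSite_addL hxl (length_toL a), toSite_toL]; exact hadj)
    rw [h'] at hna
    exact Bool.noConfusion hna

end NawK

end Summit.CriticalPhenomena.PercolationContinuityZ3.Theorems.Pcint
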